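import Summits.BirchSwinnertonDyer.BirchSwinnertonDyer.Theses.KatoDescentTamePotSupersingular
import Summits.BirchSwinnertonDyer.BirchSwinnertonDyer.Theorems.KatoDescentPotSupersingularWildFineSelmerCongruenceFact
import Literature.NumberTheory.EllipticCurves.FineSelmerClassGroupCriterion
import HarnessLib

/-!
# BC3 BIRTH SKELETON v2.1 (docstring wording only; stubs = v2) — crux `TameCoatesSujathaResidue` (item stmt-BirchSwinnertonDyer-19916; route KT =
# `Theses/KatoDescentTamePotSupersingular.lean` rev 23, rank 7; planner bsd-potss-plan g22, 2026-08-27;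
# supersedes v1 = `Lines/v1_residueClasses_plan_g21.lean`, whose S1 is kept verbatim)

The crux is Coates–Sujatha's Conjecture A (fine-Selmer-dual reading) on the TAME RESIDUE classes: non-CM
rank-0 curves, additive potentially good at an odd `p` of class T′ (`SubTprime`), `W[p]` irreducible,
`p`-adic tower not onto, whose isogeny class has a lattice-optimal member `W₀` that is EITHER Manin-dirty
(`p ∣ c(D₀)`) OR has `p ∣ ∏ c_ℓ(W₀)` carried by no single multiplicative prime `q ≠ p` — the classes the
sharp Heegner-index road (`JetchevIrreducibleReadingByName`) cannot reach.

WHAT CHANGED SINCE v1 (why a re-cut; twin of the K9 file `Cruxes/WildCoatesSujathaResidue/Lines/birth.lean` v2).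
(i) Coates–Sujatha 2005 Thm. 3.4 is now the named fact
`CoatesSujatha2005.thm34_fineSelmerDual_moduleFinite_of_classicalMuVanishes_divisionField` (p507734; plan g21's
definition request `ClassicalMuVanishes` landed), so «classical `μ(ℚ(W[p])_cyc) = 0` ⇒ (A)» is typable BY NAME.
(ii) The anchor transfer is one line for ANY `W[p]`-congruent anchor (`O6.ModPCongruent`,
`WildFineSelmerCongruenceFact.conjA_of_modPCongruent` under the named Lim–Sujatha fact — general odd `p`,
`WildFineSelmerOrdinaryAnchor.conjA_rat_of_finite_selmerInfty_pTorsion` PROVED). (iii) Planner finding (g22):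
the Deo–Ray–Sujatha class-group road (`DeoRaySujatha2023.thm39_…`) is DEAD on every (t′) row with
`p ∣ ∏ c_ℓ`: `p ∤ c_p` on (t′) (`c_p ≤ 4 < p` for `p ≥ 5`; Kodaira III/III* at `p = 3`, `e = 4`), so every
carrier is an `ℓ ≠ p`, where `p ∣ c_ℓ` forces `W(ℚ_ℓ)[p] ≠ 0` (`E¹(ℚ_ℓ) ≅ ℤ_ℓ` is uniquely `p`-divisible),
violating (c3) of Thm. 3.9 — as k9-c4 g7 already noted («(c3) is void whenever `p ∣ ∏ c_ℓ`»). Thm. 3.4 has NO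
local hypothesis: it is the only class-group road on the tame residue.

THE CUT v2 — by residue class, then by INPUT ROAD (three registered stubs):
* `stub_residue_maninDirty` (S1, size L–XL, verbatim from v1): (A) on the Manin-dirty residue class. Census
  ∅ on the KT rows. Roads: EMPTINESS first — Edixhoven 1991 Thm. 3 (`p ≥ 11 ∧ p ∣ c ⇒` type II, III, IV and
  potentially ORDINARY at `p`: the class is EMPTY at potentially supersingular `p ≥ 11`),
  Česnavičius–Neururer–Saha arXiv:1911.09446 (`ord_p c ≤ ord_p deg φ`), Cremona (`c = 1`, `N ≤ 500000`) —
  leaving `p ∈ {3,5,7}`; else the roads of S2. WHY IT MIGHT FAIL: (A) is open; a Manin-dirty optimal curve with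
  additive potentially supersingular `p ∈ {3,5,7}` may exist beyond the tables; one with `μ ≠ 0` refutes it.
  SOURCES: CoatesSujatha2005 Thm 3.4; Mazur1978; Edixhoven1991; arXiv:1911.09446; arXiv:2202.09937.
* `stub_residue_multiCarrier_anchorOrClassicalMu` (S2, size XL, load-bearing): for every multi-carrier tame
  residue row `W` at `p`, EITHER (a) a MIXED ANCHOR CERTIFICATE — an elliptic `W′/ℚ` with `W′[p] ≃ W[p]`
  (`O6.ModPCongruent W′ W p`) and EITHER (A) at `(W′,p)` OR finite `p`-torsion of `Sel_{p^∞}(W′/ℚ_cyc)` for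
  every cyclotomic datum (the currency of the tame anchor files `…TameFineSelmer{Ordinary,SupersingularUnit,
  FineUnit,FineUnitTamagawa,CMFineUnit}Anchor`, `…FineSelmerChaAnchor`, `…FineSelmerRankOneAnchor`) — OR (b)
  Iwasawa's classical `μ = 0` for the cyclotomic `ℤ_p`-extension(s) of `L = ℚ(W[p])` (`ClassicalMuVanishes`).
  ROADS: (b1) IWASAWA'S CRITERION (Iwasawa 1956; Greenberg, *Iwasawa theory — past and present*, Prop. 2.1;
  Lang GTM 121 Ch. 5 §4 Thm. 4.1 (iii)): one prime of `L` above `p` (⟺ `[ℚ_p(W[p]) : ℚ_p] = #Gal(L/ℚ)`; on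
  (t′) rows the image is a Cartan normaliser for `p ≥ 5` on most rows; `ρ̄(D_p)` has a normal Sylow-`p` with
  `I/P` and `D/I` cyclic: `ρ̄(D_p) = N(C_s(p))` is then IMPOSSIBLE for `p ≥ 5` (a cyclic normal `H` with
  `N(C_s)/H` cyclic would need the scalars to generate `C_s/H`, which fails by parity), while `ρ̄(D_p) = N(C_ns(p))`
  requires `ρ̄(I_p) ⊆ C_ns(p)` of odd index `m ∣ p − 1` with `f = 2m` (e.g. full level-2 tame inertia, `f = 2`) —
  so among full-normaliser rows only NON-SPLIT ones can qualify; smaller images case by case [v2.1 wording,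
  plan g22: v2 said «`#D_p ≤ 2(p²−1)`», right conclusion, wrong reason]) and `p ∤ h(L)` ⇒ `e_n = 0` for all `n`
  ⇒ `ClassicalMuVanishes` by `classicalMuVanishes_of_eventually_const` — a per-row FINITE check with no local
  torsion condition (named fact requested from the typer lane by plan g22); (b2) Fukuda-type stabilisation
  (`#A(L₁) = #A(L)`) on the other rows; (a1) anchors from the mod-`p` congruence family (`X_W(p) ≅ ℙ¹_ℚ` for
  `p ∈ {3,5}`, Rubin–Silverberg; finitely many candidates for `p ≥ 7`), certified by the unit-anchor files;
  (b3) the bare conjecture (Iwasawa 1973) elsewhere. WHY IT MIGHT FAIL: (A) is open; Iwasawa's `μ = 0` is open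
  for the non-abelian fields `ℚ(W[p])`; for `p ≥ 7` the congruence class of `W[p]` is finite (Mazur / Frey) and
  may contain no certifiable anchor; a multi-carrier row with neither an anchor nor `μ(ℚ(W[p])_cyc) = 0` refutes
  the stub (not (A)). SOURCES: CoatesSujatha2005 Thm 3.4; LimSujatha2018 Prop 3.2; GreenbergVatsal2000 Prop
  2.8; Iwasawa1973; Greenberg2001IwasawaPastPresent Prop 2.1; Lang1990 Ch 5 §4 Thm 4.1; RubinSilverberg1995;
  arXiv:2202.09937.
* `stub_publishedInputs_LS18_CS05` (S3, cite-level, held BY NAME; SHARED with the K9 twin by signature): Lim–Sujatha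
  2018 Prop. 3.2 (`prop32_…`, p445851) ∧ Coates–Sujatha 2005 Thm. 3.4 (`thm34_…`, p507734). Never a prover
  target; item-stated on the route on first use (director-bsd R103), like `PublishedInputsFineSelmerCM`.
`TameCoatesSujathaResidue_of` is the case split on the crux's disjunction and then on the road of S2. Three
`sorry`s, all inside `stub_*`. `residue_of_aside` (PROVED): the aside 19413 `TameFineSelmerCoatesSujatha`
((A) on ALL irreducible tower-non-surjective non-CM (t′) rows) implies the crux. Neither new stub is the crux
and none implies `O5SharpTprime`.
-/

noncomputable section

open scoped Classical

open WeierstrassCurve Literature.NumberTheory.EllipticCurves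
open Literature.NumberTheory.EllipticCurves.ModularForms
open Literature.NumberTheory.EllipticCurves.Rank1Residual
open Literature.NumberTheory.IwasawaTheory
open Summit.BirchSwinnertonDyer.Rank1Residual.O6
open Summit.BirchSwinnertonDyer.BirchSwinnertonDyer.Theorems

namespace Summit.BirchSwinnertonDyer.BirchSwinnertonDyer.Cruxes.TameCoatesSujathaResidue.Birth

/-- Statement of `stub_residue_maninDirty` (S1, verbatim from v1): Conjecture A (fine-Selmer-dual reading) on
the tame residue rows whose lattice-optimal isogenous member is Manin-dirty, `p ∣ c(D₀)`.
[CoatesSujatha2005 Thm 3.4; Mazur1978; Edixhoven1991; arXiv:1911.09446; arXiv:2202.09937] -/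
abbrev Sig.stub_residue_maninDirty : Prop :=
  ∀ (W : WeierstrassCurve ℚ) [W.IsElliptic] [W.IsGloballyMinimal] (p : ℕ) [Fact p.Prime],
    W.analyticRank = 0 → p ≠ 2 → Addv W p →
    Summit.BirchSwinnertonDyer.Rank1Residual.Additive.SubTprime W p → ¬ W.HasCM →
    W.HasIrreducibleModPGaloisRep p → ¬ (∀ n : ℕ, W.HasSurjectiveModNGaloisRep (p ^ n : ℕ)) →
    (∃ (W₀ : WeierstrassCurve ℚ) (_ : W₀.IsElliptic) (_ : W₀.IsGloballyMinimal)
        (_ : NeZero (W₀.conductorNorm ℤ))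
        (D₀ : ModularParametrizationData W₀ (W₀.conductorNorm ℤ)),
      WeierstrassCurve.IsIsogenous W W₀ ∧
      (∀ z ∈ D₀.L.lattice, ∃ w ∈ periodLattice D₀.f, z = (D₀.c : ℂ) * w) ∧ (p : ℤ) ∣ D₀.c) →
    ∀ (κ : ZpExtension ℚ p), κ.IsCyclotomic →
      ∃ (γ : Field.absoluteGaloisGroup ℚ) (D : W.FineSelmerDualData κ γ),
        Module.Finite ℤ_[p] (RestrictScalars ℤ_[p] (IwasawaAlgebra p) D.X)

/-- Statement of `stub_residue_multiCarrier_anchorOrClassicalMu` (S2): on every multi-carrier tame residue row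
at `p`, EITHER a mixed anchor certificate (a `W[p]`-congruent elliptic `W′` with (A) at `(W′,p)` or with finite
`p`-torsion of `Sel_{p^∞}(W′/ℚ_cyc)` for every cyclotomic datum) OR Iwasawa's classical `μ = 0` for the
cyclotomic `ℤ_p`-extension(s) of `ℚ(W[p])`. [CoatesSujatha2005 Thm 3.4; LimSujatha2018 Prop 3.2;
GreenbergVatsal2000 Prop 2.8; Iwasawa1973; Greenberg2001IwasawaPastPresent Prop 2.1; Lang1990 Ch 5 §4] -/
abbrev Sig.stub_residue_multiCarrier_anchorOrClassicalMu : Prop :=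
  ∀ (W : WeierstrassCurve ℚ) [W.IsElliptic] [W.IsGloballyMinimal] (p : ℕ) [Fact p.Prime],
    W.analyticRank = 0 → p ≠ 2 → Addv W p →
    Summit.BirchSwinnertonDyer.Rank1Residual.Additive.SubTprime W p → ¬ W.HasCM →
    W.HasIrreducibleModPGaloisRep p → ¬ (∀ n : ℕ, W.HasSurjectiveModNGaloisRep (p ^ n : ℕ)) →
    (∃ (W₀ : WeierstrassCurve ℚ) (_ : W₀.IsElliptic) (_ : W₀.IsGloballyMinimal)
        (_ : NeZero (W₀.conductorNorm ℤ))
        (D₀ : ModularParametrizationData W₀ (W₀.conductorNorm ℤ)),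
      WeierstrassCurve.IsIsogenous W W₀ ∧
      (∀ z ∈ D₀.L.lattice, ∃ w ∈ periodLattice D₀.f, z = (D₀.c : ℂ) * w) ∧
      (p ∣ W₀.tamagawaProduct ∧ ¬ ∃ (q : ℕ) (_ : Fact q.Prime),
        q ∣ W₀.conductorNorm ℤ ∧ ¬ q ^ 2 ∣ W₀.conductorNorm ℤ ∧ q ≠ p ∧
        padicValNat p W₀.tamagawaProduct ≤
          padicValNat p ((W₀.baseChange ℚ_[q]).localTamagawaNumber ℤ_[q]))) →
    (∃ (W' : WeierstrassCurve ℚ) (_ : W'.IsElliptic), ModPCongruent W' W p ∧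
        ((∀ (κ : ZpExtension ℚ p), κ.IsCyclotomic →
            ∃ (γ : Field.absoluteGaloisGroup ℚ) (D : W'.FineSelmerDualData κ γ),
              Module.Finite ℤ_[p] (RestrictScalars ℤ_[p] (IwasawaAlgebra p) D.X)) ∨
          ∀ (κ : ZpExtension ℚ p), κ.IsCyclotomic → Set.Finite {s : W'.selmerInfty κ | p • s = 0})) ∨
    (haveI : NeZero p := ⟨(Fact.out : p.Prime).ne_zero⟩
     ∀ κL : ZpExtension (W.divisionField p) p, κL.IsCyclotomic → ClassicalMuVanishes κL)

/-- Statement of `stub_publishedInputs_LS18_CS05` (S3, cite-level, held by name; shared with the K9 twin):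
Lim–Sujatha 2018 Prop. 3.2 and Coates–Sujatha 2005 Thm. 3.4 as the registered named Literature facts.
[LimSujatha2018 Prop 3.2 (p445851); CoatesSujatha2005 Thm 3.4 (p507734)] -/
abbrev Sig.stub_publishedInputs_LS18_CS05 : Prop :=
  LimSujatha2018.prop32_fineSelmerDual_moduleFinite_iff_of_torsionIso ∧
    CoatesSujatha2005.thm34_fineSelmerDual_moduleFinite_of_classicalMuVanishes_divisionField

/-- S1 — registered stub (Manin-dirty residue class; v1 verbatim). -/
theorem stub_residue_maninDirty : Sig.stub_residue_maninDirty := by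
  sorry

/-- S2 — registered stub (multi-carrier residue class: mixed anchor certificate or classical `μ = 0`). -/
theorem stub_residue_multiCarrier_anchorOrClassicalMu :
    Sig.stub_residue_multiCarrier_anchorOrClassicalMu := by
  sorry

/-- S3 — registered stub (cite-level: the two printed transfers, held by name). -/
theorem stub_publishedInputs_LS18_CS05 : Sig.stub_publishedInputs_LS18_CS05 := by
  sorry

/-- **The crux from the three stubs**: case split on the residue class of the optimal member, then on the
road taken on the multi-carrier class, concluding the KT route decl BY NAME. -/
theorem TameCoatesSujathaResidue_of (h₁ : Sig.stub_residue_maninDirty)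
    (h₂ : Sig.stub_residue_multiCarrier_anchorOrClassicalMu)
    (h₃ : Sig.stub_publishedInputs_LS18_CS05) :
    Summit.BirchSwinnertonDyer.BirchSwinnertonDyer.Theses.KatoDescentTamePotSupersingular.TameCoatesSujathaResidue := by
  unfold Summit.BirchSwinnertonDyer.BirchSwinnertonDyer.Theses.KatoDescentTamePotSupersingular.TameCoatesSujathaResidue
  intro W _ _ p _ hr hp2 hadd hsub hcm hirr hns hopt κ hκ
  obtain ⟨W₀, hW₀e, hW₀m, hW₀n, D₀, hiso, hlat, hdisj⟩ := hopt
  rcases hdisj with hc | ⟨htam, hno⟩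
  · exact h₁ W p hr hp2 hadd hsub hcm hirr hns ⟨W₀, hW₀e, hW₀m, hW₀n, D₀, hiso, hlat, hc⟩ κ hκ
  · obtain ⟨hLS, hCS⟩ := h₃
    rcases h₂ W p hr hp2 hadd hsub hcm hirr hns ⟨W₀, hW₀e, hW₀m, hW₀n, D₀, hiso, hlat, htam, hno⟩ with
      ⟨W', hW'e, hcong, hA' | hfin⟩ | hmu
    · haveI := hW'e
      exact WildFineSelmerCongruenceFact.conjA_of_modPCongruent hLS hp2 hcong hA' κ hκ
    · haveI := hW'e
      exact WildFineSelmerCongruenceFact.conjA_of_modPCongruent hLS hp2 hcong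
        (WildFineSelmerOrdinaryAnchor.conjA_rat_of_finite_selmerInfty_pTorsion W' hfin) κ hκ
    · exact hCS W p hp2 hmu κ hκ

/-- **The aside implies the crux** (PROVED): (A) on every irreducible tower-non-surjective non-CM (t′) row
(`TameFineSelmerCoatesSujatha`, item 19413, aside) gives (A) on the residue classes; so each class-form
certificate theorem `tameFineSelmerCoatesSujatha_of_*Certificates` of the anchor files closes this crux too. -/
theorem residue_of_aside
    (h : Summit.BirchSwinnertonDyer.BirchSwinnertonDyer.Theses.KatoDescentTamePotSupersingular.TameFineSelmerCoatesSujatha) :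
    Summit.BirchSwinnertonDyer.BirchSwinnertonDyer.Theses.KatoDescentTamePotSupersingular.TameCoatesSujathaResidue := by
  unfold Summit.BirchSwinnertonDyer.BirchSwinnertonDyer.Theses.KatoDescentTamePotSupersingular.TameCoatesSujathaResidue
  intro W _ _ p _ hr hp2 hadd hsub hcm hirr hns _ κ hκ
  exact h W p hr hp2 hadd hsub hirr hns hcm κ hκ

/-- **Road (b1) made explicit** (PROVED, below Thm. 3.4 by name): at an odd `p`, if every cyclotomic
`ℤ_p`-tower of `ℚ(W[p])` has eventually constant `p`-class-number exponent (Iwasawa's criterion gives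
`e_n = 0` throughout when `p ∤ h(ℚ(W[p]))` and one prime lies over `p`), then (A) holds at `(W,p)`.
[CoatesSujatha2005 Thm 3.4; Greenberg2001IwasawaPastPresent Prop 2.1] -/
theorem conjA_of_eventually_const_classNumberPExp
    (hCS : CoatesSujatha2005.thm34_fineSelmerDual_moduleFinite_of_classicalMuVanishes_divisionField)
    (W : WeierstrassCurve ℚ) [W.IsElliptic] (p : ℕ) [Fact p.Prime] (hp : p ≠ 2)
    (hc : haveI : NeZero p := ⟨(Fact.out : p.Prime).ne_zero⟩
      ∀ κL : ZpExtension (W.divisionField p) p, κL.IsCyclotomic →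
        ∃ c n₀ : ℕ, ∀ n, n₀ ≤ n → classNumberPExp κL n = c)
    (κ : ZpExtension ℚ p) (hκ : κ.IsCyclotomic) :
    ∃ (γ : Field.absoluteGaloisGroup ℚ) (D : W.FineSelmerDualData κ γ),
      Module.Finite ℤ_[p] (RestrictScalars ℤ_[p] (IwasawaAlgebra p) D.X) :=
  CoatesSujatha2005.fineSelmerDual_moduleFinite_of_eventually_const_classNumberPExp hCS W p hp hc κ hκ

end Summit.BirchSwinnertonDyer.BirchSwinnertonDyer.Cruxes.TameCoatesSujathaResidue.Birth

end
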